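import Summits.QuantumFields.YangMills.Theses.MarkovAtoms
import HarnessLib

/-!
# Route `MarkovAtoms`, support `FloorsGlue` (stmt-QuantumFields-22887) — the glue of the floors split

`SkewnessAtOnset → OnsetFloor → VarianceComparableFloors` (planner ym-idea-11 g7, LINE 2 «onset skewness»; critic idea-crit-9 #46).

Proof (pure real analysis, as filed): take `(r, b, R₀, Λ₀, ε₁)` from `OnsetFloor` and `ε₀` from `SkewnessAtOnset` at `(r, b, R₀, Λ₀)`;
work at the level `ε := min ε₀ ε₁`.  `OnsetFloor` gives `S, β₅` (onset set non-empty and bounded by `S`), `SkewnessAtOnset` gives the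
time-ordered triple `(f, g, h)`, `t₁, t₂, ε₃, K, β₅'`.  For `β ≥ max β₅ β₅'` and an odd-torus limit state `μ`: `M := sSup onsetV ∈ (0, S]`,
pick `s⋆ ∈ onsetV` with `M/2 < s⋆` (`exists_lt_of_lt_csSup`), apply `SkewnessAtOnset` at `s⋆` to get `s₃ ∈ [s⋆/K, s⋆]` with
`ε₃ ≤ |Q3State μ s₃ f g h|`; every `s ∈ onsetV` has `s ≤ M < 2 s⋆ ≤ 2K s₃`.  Hence the parent with `K ↦ 2K`.

Free-hands work of seat `ym-line-fcl-p3` g14 (cell ym-idea-1) for planner ym-idea-11.  THEOREMS ONLY (no `def`, no `sorry`).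
This is a SUPPORT (bookkeeping); no summit / leaf / NT / mass-gap statement is proved.
-/

set_option autoImplicit false

noncomputable section

namespace Summit.QuantumFields.YangMills.Theorems.MarkovAtoms

/-- **`FloorsGlue` (stmt-QuantumFields-22887): `SkewnessAtOnset → OnsetFloor → VarianceComparableFloors`.**
At the common level `ε = min ε₀ ε₁` the onset set is non-empty and bounded (`OnsetFloor`), its supremum `M` is approximated by a member
`s⋆ > M/2`, and the skewness window `[s⋆/K, s⋆]` at `s⋆` (`SkewnessAtOnset`) contains an `s₃` dominating every onset scale up to the
factor `2K`. [folklore] -/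
theorem floorsGlue_proof : Summit.QuantumFields.YangMills.Theses.MarkovAtoms.FloorsGlue := by
  intro hSk hOn G _ _ _ _ hG hiso
  letI : MeasurableSpace G := borel G
  haveI : BorelSpace G := ⟨rfl⟩
  obtain ⟨r, b, R₀, Λ₀, ε₁, hbc, hbs, hbi, hΛ₀, hε₁, hOn'⟩ := hOn G hG hiso
  obtain ⟨ε₀, hε₀, hSk'⟩ := hSk G hG hiso r b R₀ Λ₀ hbc hbs hΛ₀
  have hε : 0 < min ε₀ ε₁ := lt_min hε₀ hε₁
  obtain ⟨S, β₅, hS, hfloor⟩ := hOn' (min ε₀ ε₁) hε (min_le_right _ _)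
  obtain ⟨f, g, h, t₁, t₂, ε₃, K, β₅', hf, hg, hh, hε₃, hK, hskew⟩ := hSk' (min ε₀ ε₁) hε (min_le_left _ _)
  refine ⟨r, b, f, g, h, R₀, Λ₀, min ε₀ ε₁, ε₃, 2 * K, max β₅ β₅', t₁, t₂, hbc, hbs, hbi, hΛ₀, hf, hg, hh, hε, hε₃,
    by linarith, ?_⟩
  intro β hβ μ hμ V onsetV
  obtain ⟨⟨s₀, hs₀⟩, hbd⟩ := hfloor β (le_trans (le_max_left _ _) hβ) μ hμ
  have hsk := hskew β (le_trans (le_max_right _ _) hβ) μ hμ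
  -- the onset set is non-empty, bounded above, and consists of positive scales
  have hne : onsetV.Nonempty := ⟨s₀, hs₀⟩
  have hba : BddAbove onsetV := ⟨S, fun s hs => hbd s hs⟩
  have hMpos : 0 < sSup onsetV := lt_of_lt_of_le hs₀.1 (le_csSup hba hs₀)
  -- a member above half the supremum
  obtain ⟨s', hs', hMs'⟩ := exists_lt_of_lt_csSup hne (half_lt_self hMpos)
  obtain ⟨s₃, hs₃, hsK, -, hQ⟩ := hsk s' hs'
  refine ⟨s₃, hs₃, hQ, fun s hs => ?_⟩
  have h1 : s ≤ sSup onsetV := le_csSup hba hs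
  calc s ≤ sSup onsetV := h1
    _ ≤ 2 * s' := by linarith
    _ ≤ 2 * (K * s₃) := by linarith
    _ = 2 * K * s₃ := by ring

end Summit.QuantumFields.YangMills.Theorems.MarkovAtoms

end
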